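import Literature.NumberTheory.LFunctions.ZeroCounting
import Mathlib.Analysis.SpecialFunctions.ImproperIntegrals
import Mathlib.Analysis.Calculus.MeanValue
import Mathlib.NumberTheory.Harmonic.Bounds
import HarnessLib

/-!
# Barrier: the Berry–Keating operator `H = −i(x d/dx + 1/2)` cannot have the Riemann zeros as eigenvalues — not on `L²(ℝ₊)`, not on any compact quantum graph (Endres–Steiner 2010)

Barrier catalogue `Literature/Barriers/RiemannHypothesis/` (D-0021), entry `BerryKeatingOperator`
(namespace `Literature.Barriers.RiemannHypothesis`; the catalogued declaration is `BerryKeatingOperator`,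
proved from the tree's named fact `Literature.NumberTheory.LFunctions.riemann_von_mangoldt` as
`BerryKeatingOperator_of_riemann_von_mangoldt`; its half-line half is proved outright,
`halfLine_eigenfunction_eq_zero`).

## The technique (Hilbert–Pólya via quantising `H_cl = xp`; Berry–Keating 1999)

Endres–Steiner, §1–2: Berry and Keating "speculated that some quantization of [the classical
Hamiltonian `H_cl(x,p) = xp`] might yield the hypothetical Hilbert–Pólya operator possessing as
eigenvalues the nontrivial Riemann zeros", supported by the semiclassical count: the regularised
phase-space volume under `xp = E` reproduces the Riemann–von Mangoldt main terms
`N(E) = (E/2π)(log(E/2π) − 1) + 7/8 + …` (ES (5)–(6)). "With the standard choice `𝓗 = L²(ℝ, dx)`,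
the simplest operator corresponding to [`xp`] is obtained by Weyl ordering … leading to the
Berry–Keating operator `H_BK := ½(xp + px) = −iħ(x d/dx + ½)`" (ES (2.3)). The tree's formal
surrogate of Hilbert–Pólya is `Literature.Analysis.UnboundedOperators.HilbertPolyaConjecture`
(`Literature/Analysis/UnboundedOperators/HilbertPolya.lean`).

## The obstruction (what this file vendors)

* **Half-line (ES §2, p. 4).** "`H_BK` acting on `𝒟(ℝ_>)` … is essentially self-adjoint … The
  operator `H_BK` is unbounded and does not have a discrete spectrum corresponding to bound states,
  but rather has a continuous spectrum `λ ∈ ℝ`": the eigenvalue equation `H_BK ψ = λψ`, i.e.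
  `x ψ′ = sψ` with `s = −½ + iλ` (ES (2.6), `ħ = 1`), has on `ℝ_>` "the unique solution"
  `ψ_k(x) = x^{−1/2+ik}/√(2π)`, "which is obviously not in `L²(ℝ_>, dx)`" (ES (2.9)); abstract: "the
  spectrum of `H_BK` defined on `L²(ℝ_>, dx)` is purely continuous and thus this quantization of
  `H_BK` cannot yield the hypothetical Hilbert–Pólya operator". PROVED here in the classical-solution
  form: a differentiable `ψ` on `(0, ∞)` with `−i(xψ′ + ψ/2) = kψ` (`k` real) and
  `∫₀^∞ |ψ|² < ∞` vanishes identically (`halfLine_eigenfunction_eq_zero`; the solution formula is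
  `eq_mul_exp_of_eulerODE`, non-integrability of `1/x` is Mathlib's `not_integrableOn_Ioi_inv`).
* **Compact quantum graphs (ES Thm. 15.5 and Thm. 15.6).** Theorem 15.5 (Weyl's law for `H_BK`):
  "Given the positive eigenvalues of some `(H_BK; A, B)` [any self-adjoint realization on a compact
  metric graph, classified in Prop. 8.1, total length `𝔏`] in increasing order denoted by
  `λ_n = k_n`. Then for the counting function `N(k) := #{n; k_n ≤ k}` the following asymptotic law
  holds `N(k) ∼ (𝔏/π) k` for `k → ∞`" (and Thm. 15.4: `N(λ) ∼ (𝔏/π)√λ` for `H_BK²`). "Comparing the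
  theorems [15.4] and [15.5] with the asymptotics of the counting function for the nontrivial
  Riemann zeros [(1.2), `N(E) ∼ (E/2π) log E`], we therefore can conclude: **Theorem 15.6 (No-go
  theorem).** Neither `H_BK` nor `H_BK²` yields as eigenvalues the nontrivial Riemann zeros if these
  are self-adjoint realizations on any compact graph." The operators `(H_BK; A, B)` on metric graphs
  are not formalised; what is formalised and PROVED is the comparison step: by the Riemann–von
  Mangoldt formula (the tree's named fact `Literature.NumberTheory.LFunctions.riemann_von_mangoldt`) `N_ζ(T)/T → ∞`
  (`tendsto_zetaZeroCount_div_atTop`), so no counting function with a linear Weyl law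
  (`HasLinearWeylLaw N a`: `N(k)/k → a`) agrees with `N_ζ` from some point on — indeed
  `N(T) < N_ζ(T)` for all large `T` (`eventually_lt_zetaZeroCount_of_hasLinearWeylLaw`).

## References

* [EndresSteiner2010] S. Endres, F. Steiner, *The Berry–Keating operator on `L²(ℝ_>, dx)` and on
  compact quantum graphs with general self-adjoint realizations*, J. Phys. A 43 (2010) 095204;
  arXiv:0912.3183 (read: abstract, §1–2 pp. 3–5, §4 p. 7, §8–9, §15 pp. 21–22 with Thms. 15.4–15.6,
  §17).
* [BerryKeating1999] M. V. Berry, J. P. Keating, *The Riemann zeros and eigenvalue asymptotics*,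
  SIAM Review 41 (1999), 236–266 (as cited in ES; not re-read here).
* [Mangoldt1905] / Titchmarsh Thm. 9.4 — the Riemann–von Mangoldt formula, via the tree's
  `Literature.NumberTheory.LFunctions.riemann_von_mangoldt` (`Literature/NumberTheory/LFunctions/ZeroCounting.lean`).
-/

noncomputable section

open Filter Asymptotics Topology Set MeasureTheory Complex

namespace Literature.Barriers.RiemannHypothesis

/-! ## Half-line: the eigenvalue equation of `H_BK = −i(x d/dx + 1/2)` has no `L²(0, ∞)` solution -/

/-- **Euler's homogeneous ODE on `(0, ∞)`.** If `ψ` is differentiable on `(0, ∞)` with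
`x ψ′(x) = s ψ(x)` there, then `ψ(x) = ψ(1) x^s = ψ(1) exp(s log x)` ("an eigenfunction `ψ` of `H_BK`
must be a homogeneous function with (complex) degree `s = −½ + ik` … the eigenvalue problem (2.6) …
possesses for `x ∈ ℝ_>` the unique solution (2.9)"). Proof: `ψ(x) exp(−s log x)` has zero derivative
on the connected open set `(0, ∞)`. [cite: EndresSteiner2010, §2 (2.6)–(2.9) and (2.21)] -/
theorem eq_mul_exp_of_eulerODE {s : ℂ} {ψ ψ' : ℝ → ℂ}
    (hd : ∀ x : ℝ, 0 < x → HasDerivAt ψ (ψ' x) x)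
    (hODE : ∀ x : ℝ, 0 < x → (x : ℂ) * ψ' x = s * ψ x) :
    ∀ x : ℝ, 0 < x → ψ x = ψ 1 * Complex.exp (s * (Real.log x : ℂ)) := by
  set g : ℝ → ℂ := fun x ↦ ψ x * Complex.exp (-(s * (Real.log x : ℂ))) with hg
  have hE : ∀ x, 0 < x → HasDerivAt (fun y : ℝ ↦ Complex.exp (-(s * (Real.log y : ℂ))))
      (Complex.exp (-(s * (Real.log x : ℂ))) * (-(s * ((x⁻¹ : ℝ) : ℂ)))) x := by
    intro x hx
    have h1 : HasDerivAt (fun y : ℝ ↦ ((Real.log y : ℝ) : ℂ)) ((x⁻¹ : ℝ) : ℂ) x :=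
      (Real.hasDerivAt_log hx.ne').ofReal_comp
    exact ((h1.const_mul s).neg).cexp
  have hgd : ∀ x, 0 < x → HasDerivAt g 0 x := by
    intro x hx
    have hx0 : (x : ℂ) ≠ 0 := by exact_mod_cast hx.ne'
    have hψ' : ψ' x = s * ψ x * (x : ℂ)⁻¹ := by
      rw [← hODE x hx, mul_comm (x : ℂ) (ψ' x), mul_inv_cancel_right₀ hx0]
    refine ((hd x hx).mul (hE x hx)).congr_deriv ?_
    rw [hψ']
    push_cast
    ring
  have hdiff : DifferentiableOn ℝ g (Ioi 0) := fun x hx ↦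
    (hgd x hx).differentiableAt.differentiableWithinAt
  have hderiv : (Ioi (0 : ℝ)).EqOn (deriv g) 0 := fun x hx ↦ (hgd x hx).deriv
  intro x hx
  have hconst : g x = g 1 :=
    isOpen_Ioi.is_const_of_deriv_eq_zero isPreconnected_Ioi hdiff hderiv hx
      (Set.mem_Ioi.2 one_pos)
  have hg1 : g 1 = ψ 1 := by simp [hg]
  rw [hg1] at hconst
  have hexp : ψ x * (Complex.exp (s * (Real.log x : ℂ)))⁻¹ = ψ 1 := by
    rw [← Complex.exp_neg]
    exact hconst
  exact (mul_inv_eq_iff_eq_mul₀ (Complex.exp_ne_zero _)).1 hexp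

/-- `|exp(s log x)|² = x^{2 Re s}`; for `Re s = −½` this is `1/x` ("`ψ_k(x) = x^{−1/2+ik}/√(2π)` …
obviously not in `L²(ℝ_>, dx)`"). [cite: EndresSteiner2010, §2 (2.9)] -/
theorem norm_exp_mul_log_sq {s : ℂ} (hs : s.re = -1 / 2) {x : ℝ} (hx : 0 < x) :
    ‖Complex.exp (s * (Real.log x : ℂ))‖ ^ 2 = x⁻¹ := by
  rw [Complex.norm_exp, Complex.mul_re, Complex.ofReal_re, Complex.ofReal_im, mul_zero, sub_zero,
    hs, sq, ← Real.exp_add, ← Real.exp_log hx, Real.log_exp, ← Real.exp_neg]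
  congr 1
  ring

/-- **The Berry–Keating eigenvalue equation on the half-line** `H_BK ψ = k ψ`,
`H_BK = −i(x d/dx + ½)` (`ħ = 1`), for a function `ψ` with derivative `ψ′` on `(0, ∞)`.
[cite: EndresSteiner2010, §2 (2.3)–(2.5)] -/
def IsBerryKeatingEigenfunction (k : ℝ) (ψ ψ' : ℝ → ℂ) : Prop :=
  (∀ x : ℝ, 0 < x → HasDerivAt ψ (ψ' x) x) ∧
    ∀ x : ℝ, 0 < x → -I * ((x : ℂ) * ψ' x + ψ x / 2) = (k : ℂ) * ψ x

/-- **Half-line no-go (ES §2; abstract).** A (classical) solution of `H_BK ψ = kψ`, `k ∈ ℝ`, on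
`(0, ∞)` which is square-integrable there vanishes identically: the solutions are exactly
`ψ(1) x^{−1/2+ik}`, and `|x^{−1/2+ik}|² = 1/x` is not integrable. So the Weyl-ordered `xp` on
`L²(ℝ_>, dx)` has no eigenvalues at all ("does not have a discrete spectrum corresponding to bound
states, but rather has a continuous spectrum `λ ∈ ℝ`"; "thus this quantization of `H_BK` cannot
yield the hypothetical Hilbert–Pólya operator"). [cite: EndresSteiner2010, §2 (2.6)–(2.9) and abstract] -/
theorem halfLine_eigenfunction_eq_zero (k : ℝ) {ψ ψ' : ℝ → ℂ}
    (hψ : IsBerryKeatingEigenfunction k ψ ψ')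
    (hL2 : IntegrableOn (fun x ↦ ‖ψ x‖ ^ 2) (Ioi 0)) : ∀ x, 0 < x → ψ x = 0 := by
  obtain ⟨hd, heig⟩ := hψ
  set s : ℂ := -1 / 2 + k * I with hs_def
  have hs : s.re = -1 / 2 := by simp [hs_def]
  have hODE : ∀ x : ℝ, 0 < x → (x : ℂ) * ψ' x = s * ψ x := by
    intro x hx
    have h1 : I * (-I * ((x : ℂ) * ψ' x + ψ x / 2)) = I * ((k : ℂ) * ψ x) :=
      congrArg (fun z ↦ I * z) (heig x hx)
    rw [← mul_assoc, mul_neg, Complex.I_mul_I, neg_neg, one_mul] at h1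
    rw [hs_def]
    linear_combination h1
  have hsol := eq_mul_exp_of_eulerODE hd hODE
  by_cases h1 : ψ 1 = 0
  · intro x hx
    rw [hsol x hx, h1, zero_mul]
  · exfalso
    have hc : 0 < ‖ψ 1‖ ^ 2 := by positivity
    have hI1 : IntegrableOn (fun x : ℝ ↦ ‖ψ 1‖ ^ 2 * x⁻¹) (Ioi 1) := by
      refine (hL2.mono_set (Ioi_subset_Ioi zero_le_one)).congr_fun (fun x hx ↦ ?_)
        measurableSet_Ioi
      have hx : 0 < x := lt_trans one_pos hx
      simp only
      rw [hsol x hx, norm_mul, mul_pow, norm_exp_mul_log_sq hs hx]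
    have hI2 : IntegrableOn (fun x : ℝ ↦ x⁻¹) (Ioi 1) := by
      have h3 : IntegrableOn (fun x : ℝ ↦ (‖ψ 1‖ ^ 2)⁻¹ * (‖ψ 1‖ ^ 2 * x⁻¹)) (Ioi 1) :=
        hI1.const_mul ((‖ψ 1‖ ^ 2)⁻¹)
      refine h3.congr_fun (fun x _ ↦ ?_) measurableSet_Ioi
      show (‖ψ 1‖ ^ 2)⁻¹ * (‖ψ 1‖ ^ 2 * x⁻¹) = x⁻¹
      rw [← mul_assoc, inv_mul_cancel₀ hc.ne', one_mul]
    exact not_integrableOn_Ioi_inv hI2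

/-! ## Compact quantum graphs: a linear Weyl law is incompatible with the Riemann–von Mangoldt count -/

/-- **Linear Weyl law** for a counting function `N`: `N(k)/k → a` (for `a > 0` this is
`N(k) ∼ a k`; any real `a` is allowed here, which only strengthens the no-go below)
(ES Thm. 15.5: every self-adjoint realization `(H_BK; A, B)` on a compact metric graph of total
length `𝔏` has `N(k) ∼ (𝔏/π) k`; Thm. 15.4: `N(λ) ∼ (𝔏/π)√λ` for `H_BK²`, i.e. again linear in the
wave number `k = √λ`). [cite: EndresSteiner2010, Thm. 15.4–15.5] -/
def HasLinearWeylLaw (N : ℝ → ℝ) (a : ℝ) : Prop :=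
  Tendsto (fun k ↦ N k / k) atTop (𝓝 a)

/-- The Riemann–von Mangoldt main term divided by `T` tends to `+∞`:
`((T/2π) log(T/2π) − T/2π)/T = (log(T/2π) − 1)/2π → ∞`. [folklore] -/
theorem tendsto_vonMangoldtMain_div_atTop :
    Tendsto (fun T : ℝ ↦ (T / (2 * Real.pi) * Real.log (T / (2 * Real.pi)) - T / (2 * Real.pi)) / T)
      atTop atTop := by
  have h2π : 0 < 2 * Real.pi := by positivity
  have hlog : Tendsto (fun T : ℝ ↦ Real.log (T / (2 * Real.pi))) atTop atTop :=
    Real.tendsto_log_atTop.comp (tendsto_id.atTop_div_const h2π)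
  have hmain : Tendsto (fun T : ℝ ↦ (Real.log (T / (2 * Real.pi)) - 1) / (2 * Real.pi)) atTop atTop :=
    (tendsto_atTop_add_const_right _ (-1) hlog).atTop_div_const h2π
  refine hmain.congr' ?_
  filter_upwards [eventually_gt_atTop 0] with T hT
  field_simp

/-- **Riemann–von Mangoldt ⇒ superlinear growth.** From the tree's named fact
`Literature.NumberTheory.LFunctions.riemann_von_mangoldt` (`N(T) = (T/2π) log(T/2π) − T/2π + O(log T)`): `N_ζ(T)/T → ∞`.
[cite: Mangoldt1905, Titchmarsh Thm. 9.4] -/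
theorem tendsto_zetaZeroCount_div_atTop (h : Literature.NumberTheory.LFunctions.riemann_von_mangoldt) :
    Tendsto (fun T : ℝ ↦ (Literature.NumberTheory.LFunctions.zetaZeroCount T : ℝ) / T) atTop atTop := by
  -- the error term divided by `T` tends to `0`
  have herr : Tendsto (fun T : ℝ ↦ ((Literature.NumberTheory.LFunctions.zetaZeroCount T : ℝ) -
      (T / (2 * Real.pi) * Real.log (T / (2 * Real.pi)) - T / (2 * Real.pi))) / T) atTop (𝓝 0) :=
    (h.trans_isLittleO Real.isLittleO_log_id_atTop).tendsto_div_nhds_zero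
  have hsum := tendsto_atTop_add_right_of_le' atTop (-1 : ℝ) tendsto_vonMangoldtMain_div_atTop
    (herr.eventually (eventually_ge_nhds (by norm_num : (-1 : ℝ) < 0)))
  refine hsum.congr' ?_
  filter_upwards [eventually_gt_atTop 0] with T hT
  field_simp
  ring

/-- **The comparison step of ES Theorem 15.6, proved.** If `N` obeys a linear Weyl law then
`N(T) < N_ζ(T)` for all large `T` (given Riemann–von Mangoldt); in particular `N` is not the
counting function of the zeta ordinates from any point on. [cite: EndresSteiner2010, Thm. 15.6 (proof: "Comparing the theorems … with the asymptotics of the counting function for the nontrivial Riemann zeros")] -/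
theorem eventually_lt_zetaZeroCount_of_hasLinearWeylLaw (h : Literature.NumberTheory.LFunctions.riemann_von_mangoldt)
    {N : ℝ → ℝ} {a : ℝ} (hN : HasLinearWeylLaw N a) :
    ∀ᶠ T in atTop, N T < Literature.NumberTheory.LFunctions.zetaZeroCount T := by
  have h1 : ∀ᶠ T in atTop, N T / T < a + 1 := hN.eventually (eventually_lt_nhds (by linarith))
  have h2 : ∀ᶠ T in atTop, a + 1 < (Literature.NumberTheory.LFunctions.zetaZeroCount T : ℝ) / T :=
    (tendsto_zetaZeroCount_div_atTop h).eventually_gt_atTop (a + 1)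
  filter_upwards [h1, h2, eventually_gt_atTop 0] with T hT1 hT2 hT
  have := hT1.trans hT2
  rwa [div_lt_div_iff_of_pos_right hT] at this

/-! ## The barrier -/

/-- **Barrier `BerryKeatingOperator` (Endres–Steiner 2010: §2 and Theorems 15.5–15.6).**
(i) On the half-line, the Weyl-ordered `xp`, `H_BK = −i(x d/dx + ½)` on `L²(ℝ_>, dx)`, has no
square-integrable eigenfunction for any real `k` — every classical solution of `H_BK ψ = kψ` in
`L²(0, ∞)` is zero; (ii) a counting function with a linear Weyl law `N(k) ∼ a k` — which by ES
Thm. 15.5 (resp. 15.4) is the eigenvalue (resp. wave-number) count of every self-adjoint realization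
`(H_BK; A, B)` (resp. `(H_BK²; A, B)`) on a compact metric graph, `a = 𝔏/π` — is eventually
strictly below the zeta zero count `N_ζ(T) = #{ρ : 0 < Im ρ ≤ T}` (with multiplicity), so it is
not `N_ζ`: "Neither `H_BK` nor `H_BK²` yields as eigenvalues the nontrivial Riemann zeros if these
are self-adjoint realizations on any compact graph" (Thm. 15.6). Proved from the tree's
Riemann–von Mangoldt fact (`BerryKeatingOperator_of_riemann_von_mangoldt`); (i) outright.

BARRIER (structured block, D-0021):
- technique_class: Hilbert-Polya Berry-Keating xp-Hamiltonian xp-quantisation Weyl-ordered-xp dilation-generator half-line-L2 quantum-graph self-adjoint-extensions Weyl-law-mismatch spectral-realisation-of-zeros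
- blocks: realising the ordinates of the nontrivial zeros (counted with multiplicity, counting function `Literature.NumberTheory.LFunctions.zetaZeroCount`) as the spectrum of the Weyl-ordered operator `H_BK = −i(x d/dx + 1/2)` on `L²(ℝ_>, dx)`, or of any self-adjoint realization of `H_BK` or of `H_BK² = −x²d²/dx² − 2x d/dx − 1/4` on a compact metric graph (classified by Lagrangian subspaces, ES Prop. 8.1 / 11.1) — the Berry–Keating instance of `Literature.Analysis.UnboundedOperators.HilbertPolyaConjecture` [cite: EndresSteiner2010, abstract, §2, Prop. 8.1, Prop. 11.1 and Thm. 15.6] [cite: BerryKeating1999, §1]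
- because: on `ℝ_>` the eigen-equation `xψ′ = (−1/2 + ik)ψ` has only the solutions `c·x^{−1/2+ik}`, `|x^{−1/2+ik}|² = 1/x ∉ L¹(0,∞)`, so the spectrum is purely continuous (`halfLine_eigenfunction_eq_zero`) [cite: EndresSteiner2010, §2 (2.6)–(2.9)]; on a compact graph every self-adjoint realization has discrete spectrum with Weyl law `N(k) ∼ (𝔏/π)k` (trace formula Thm. 15.2 / Karamata), linear in `k`, while `N_ζ(T) ∼ (T/2π) log T` [cite: EndresSteiner2010, Thm. 15.5 and Thm. 15.6]
- evasions_known: none published for `xp` itself within these realizations (AUDIT 2026-08-16: outside them — infinitely many edges, deformed `xp`, other Hilbert spaces, non-self-adjoint similarity transforms — see the `not_blocked:` line of `BerryKeatingOperatorNarrow` below [cite: EggerSteiner2011, Introduction]); ES note only a formal analogy — in the `L²(ℝ_>)` dynamics a wave packet "gets no contribution … exactly at the wave numbers `k` corresponding to the conjectured nontrivial Riemann zeros … reminiscent to the absorption spectrum interpretation … by Connes, but of course reveals no insight to the position of the nontrivial Riemann zeros" [cite: EndresSteiner2010, Example 16.1]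
- status: established
- scope_caveats: (i) is proved for classical (differentiable) solutions of the eigenvalue ODE — the operator-theoretic statement "purely continuous spectrum of the self-adjoint closure" is prose here; (ii) formalises only the comparison step of Thm. 15.6 — the Weyl law Thm. 15.5/15.4 for `(H_BK; A, B)` on metric graphs is not formalised (no quantum graphs in the tree) and enters as the hypothesis `HasLinearWeylLaw N a`; untouched: non-compact graphs, other Hilbert spaces or orderings of `xp`, regularised/modified `xp` Hamiltonians (Berry–Keating's truncations, Connes' adelic space), and Hilbert–Pólya in general (`Literature.Analysis.UnboundedOperators.HilbertPolyaConjecture`) [cite: EndresSteiner2010, §17]; AUDIT 2026-08-16 (narrowing): "compact graph" in ES Thm. 15.5–15.6 means a FINITE graph — "a finite set of vertices … and a finite set of edges", each edge an interval `[a_e, b_e]` with `0 < a_e < b_e < ∞` (ES §6) — so (ii) covers finite graphs and finite direct sums only (`hasLinearWeylLaw_finset_sum`); graphs with countably many edges (even with compact metric closure, e.g. a wedge of loops of log-lengths `1/n`) and countable direct sums of the very same layers are NOT covered and do attain the `T log T` law: the Egger né Endres–Steiner infinite Dirichlet graph has `N_ES(T)/N_ζ(T) → 1` (`tendsto_esGraphCount_div_zetaZeroCount`,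 `BerryKeatingOperatorNarrow`) [cite: EndresSteiner2010, §6] [cite: EggerSteiner2011, Introduction and §4 (11c)]

[cite: EndresSteiner2010, §2 and Theorems 15.5–15.6] -/
def BerryKeatingOperator : Prop :=
  (∀ k : ℝ, ∀ ψ ψ' : ℝ → ℂ, IsBerryKeatingEigenfunction k ψ ψ' →
      IntegrableOn (fun x ↦ ‖ψ x‖ ^ 2) (Ioi 0) → ∀ x, 0 < x → ψ x = 0) ∧
    ∀ (N : ℝ → ℝ) (a : ℝ), HasLinearWeylLaw N a →
      ∀ᶠ T in atTop, N T < Literature.NumberTheory.LFunctions.zetaZeroCount T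

/-- The barrier from the tree's Riemann–von Mangoldt fact; part (i) is unconditional.
[cite: EndresSteiner2010, §2 and Thm. 15.6] -/
theorem BerryKeatingOperator_of_riemann_von_mangoldt (h : Literature.NumberTheory.LFunctions.riemann_von_mangoldt) :
    BerryKeatingOperator :=
  ⟨fun k _ψ _ψ' hψ hL2 ↦ halfLine_eigenfunction_eq_zero k hψ hL2,
    fun _N _a hN ↦ eventually_lt_zetaZeroCount_of_hasLinearWeylLaw h hN⟩

/-- Consequence (ii) in the "not the zeta count" form: a linear-Weyl-law counting function does not
agree with `N_ζ` for all large `T`, let alone for all `T`. [cite: EndresSteiner2010, Thm. 15.6] -/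
theorem BerryKeatingOperator.not_eventuallyEq (hB : BerryKeatingOperator) {N : ℝ → ℝ} {a : ℝ}
    (hN : HasLinearWeylLaw N a) : ¬ ∀ᶠ T in atTop, N T = Literature.NumberTheory.LFunctions.zetaZeroCount T := by
  intro hEq
  obtain ⟨T, hlt, heq⟩ := ((hB.2 N a hN).and hEq).exists
  exact hlt.ne heq

/-- Non-vacuity of (i): the printed eigenfunctions `x^{−1/2+ik} = exp((−1/2 + ik) log x)` do solve
`H_BK ψ = kψ` on `(0, ∞)` (so the content of (i) is their non-square-integrability, not the absence
of solutions). [cite: EndresSteiner2010, §2 (2.9)] -/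
theorem isBerryKeatingEigenfunction_cpow (k : ℝ) :
    IsBerryKeatingEigenfunction k
      (fun x ↦ Complex.exp ((-1 / 2 + k * I) * (Real.log x : ℂ)))
      (fun x ↦ Complex.exp ((-1 / 2 + k * I) * (Real.log x : ℂ)) *
        ((-1 / 2 + k * I) * ((x⁻¹ : ℝ) : ℂ))) := by
  refine ⟨fun x hx ↦ ?_, fun x hx ↦ ?_⟩
  · have h1 : HasDerivAt (fun y : ℝ ↦ ((Real.log y : ℝ) : ℂ)) ((x⁻¹ : ℝ) : ℂ) x :=
      (Real.hasDerivAt_log hx.ne').ofReal_comp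
    exact (h1.const_mul _).cexp
  · have hx0 : (x : ℂ) ≠ 0 := by exact_mod_cast hx.ne'
    set E := Complex.exp ((-1 / 2 + k * I) * (Real.log x : ℂ))
    have hcancel : (x : ℂ) * (E * ((-1 / 2 + k * I) * ((x⁻¹ : ℝ) : ℂ))) =
        E * (-1 / 2 + k * I) := by
      push_cast
      field_simp
    rw [hcancel]
    linear_combination (-(k : ℂ) * E) * Complex.I_sq

/-! ## Audit 2026-08-16 (D-0021 barrier audit): part (ii) blocks FINITE graphs only — the narrowed block `BerryKeatingOperatorNarrow`

What ES Theorem 15.6 quantifies over. ES §6: "A compact graph `Γ = (𝒱, ℰ, 𝐈)` is a finite set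
of vertices … and a finite set of edges … Each edge `e` is assigned an interval `I_e = [a_e, b_e]`
with `0 < a_e < b_e < ∞`"; the Hilbert space is `⊕_{i=1}^E L²([a_i, b_i], dx)` (ES §7 (7.1)) and
the Weyl law `N(k) ∼ (𝔏/π) k` has `𝔏 = Σ_{i=1}^E 𝔩_i < ∞` (ES §15). So "any compact graph" in the
no-go theorem means: finitely many edges, each a compact sub-interval of `(0, ∞)` (neither `x = 0`
nor `x = ∞` on the graph), total log-length finite. Within that class the obstruction is robust and
closed under finite direct sums (`hasLinearWeylLaw_finset_sum`).

The boundary, in print and proved below. One year later the same authors (Egger né Endres–Steiner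
2011) studied "a quantum graph consisting of an infinite chain of edges … `I_n = [0, l_n]` … with
length `l_n = π/n`" whose Dirichlet Laplacian has "purely discrete" spectrum, wave numbers
`k_{n,m} = n m` with multiplicity `d(k)` (their (8)), counting function
`N(x) = Σ_{n ≤ x} d(n) = x ln x + (2γ − 1)x + 1/4 + O(√x)` (Dirichlet; their (10)–(11)), i.e. the
"non-standard Weyl asymptotics `𝒩(λ) = (√λ/2) ln λ + O(√λ)`", "whose leading term agrees after an
obvious rescaling of the edge lengths by a factor `1/2π` with the leading term of the counting
function for the nontrivial Riemann zeros. This is interesting for the search of the highly desired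
Hilbert-Polya operator … and suggests that one should consider infinite quantum graphs for this
purpose (see [ES 2010] …)" (Introduction). Each edge separately is blocked by (ii) — its count
`⌊T/(2πn)⌋` has the linear Weyl law `1/(2πn)` (`hasLinearWeylLaw_esLayerCount`) — but the countable
direct sum `N_ES(T) = Σ_n ⌊T/(2πn)⌋ = D(T/2π)` has no linear Weyl law
(`not_hasLinearWeylLaw_esGraphCount`) and, given Riemann–von Mangoldt, `N_ES(T)/N_ζ(T) → 1`
(`tendsto_esGraphCount_div_zetaZeroCount`). (The same count arises for `H_BK` itself on the wedge of
loops `[1, e^{1/n}]`, `n ≥ 1`, with the cyclic vertex condition `√b ψ(b) = √a ψ(a)` on each loop —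
positive eigenvalues `2π n m`, the eigenvalue `0` common to all loops aside; with the anti-cyclic condition `√b ψ(b) = −√a ψ(a)` the spectrum `{(2m+1)π n}` is purely discrete with the same leading count — a graph with infinitely many edges whose metric closure is compact.)
Only the leading order matches: the second terms are `(2γ−1)T/2π` versus `−T/2π`, and the spectrum
`{n m}` is that of an integrable system.

Other published lines that the technique-class words of the original block ("Hilbert-Polya",
"xp-Hamiltonian", "dilation-generator", "spectral-realisation-of-zeros") might seem to cover but
the theorems do not touch: modified `xp` Hamiltonians `x(p + ℓ_p²/p)` on `L²(ℓ_x, ∞)` —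
self-adjoint, discrete spectrum, "its spectrum coincides with the average Riemann zeros",
`n(E) ≃ (E/2π)(log(E/ℓ_xℓ_p) − 1) − 1/2` (Sierra–Rodríguez-Laguna 2011; Sierra 2019 §5 (h10)) — and
the `x ↔ p` symmetric compact version `(x + ℓ_x²/x)(p + ℓ_p²/p)` (Berry–Keating 2011); the dilation
generator on other spaces — Connes' cokernel `L²_δ(C_k)/Im E`, on which it "has discrete spectrum,
`Sp D_χ ⊂ iℝ` is the set of imaginary parts of zeros of [`L(χ̃, ·)`] which have real part equal to
`1/2`" (Connes 1999, Thm. 1), Burnol's quotient/Sonine spaces `HP_λ` (Burnol 2004, §5: the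
candidates `t^{−ρ}` "do not belong to `L²`"), Srednicki's compression of `H_BK` "projected onto the
subspace of oscillator eigenfunctions of lower level", whose eigenvalues are the zeros of the Mellin
transform of an oscillator eigenfunction (local RH; Srednicki 2011); non-self-adjoint similarity
transforms of `xp` with a boundary condition at `x = 0` equivalent to `ζ(s) = 0`
(Bender–Brody–Müller 2017; Yakaboylu 2024, `Ĥ = Ŝ Ĥ_BK Ŝ⁻¹` on `L²[0, ∞)`); Bethe-ansatz
quantisation conditions reproducing the critical zeros (LeClair–Mussardo 2024). None of these is
refuted or supported here; they are listed so that the barrier is not read more broadly than its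
theorems.

## References (added by the audit)

* [EggerSteiner2011] S. Egger né Endres, F. Steiner, *An exact trace formula and zeta functions for
  an infinite quantum graph with a non-standard Weyl asymptotics*, J. Phys. A 44 (2011) 185202;
  arXiv:1104.1364 (read: abstract, §1, §3 (8), §4 (10)–(11c)).
* [SierraRodriguezLaguna2011] G. Sierra, J. Rodríguez-Laguna, *The `H = xp` model revisited and the
  Riemann zeros*, Phys. Rev. Lett. 106 (2011) 200201; arXiv:1102.5356 (abstract).
* [BerryKeating2011] M. V. Berry, J. P. Keating, *A compact hamiltonian with the same asymptotic mean
  spectral density as the Riemann zeros*, J. Phys. A 44 (2011) 285203 (via Sierra 2019 §5).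
* [Sierra2019] G. Sierra, *The Riemann zeros as spectrum and the Riemann hypothesis*, Symmetry 11
  (2019) 494; arXiv:1601.01797 (§1, §5).
* [Connes1999] A. Connes, Selecta Math. 5 (1999) 29–106; arXiv:math/9811068 (§III Thm. 1).
* [Burnol2004] J.-F. Burnol, *On Fourier and Zeta(s)*, Forum Math. 16 (2004) 789–840 (§5).
* [Srednicki2011] M. Srednicki, J. Phys. A 44 (2011) 305202; arXiv:1104.1850 (abstract).
* [BenderBrodyMuller2017] C. M. Bender, D. C. Brody, M. P. Müller, Phys. Rev. Lett. 118 (2017)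
  130201; arXiv:1608.03679 (abstract).
* [Yakaboylu2024] E. Yakaboylu, J. Phys. A 57 (2024) 235204; arXiv:2309.00405 (§1).
* [LeClairMussardo2024] A. LeClair, G. Mussardo, JHEP 04 (2024) 062; arXiv:2307.01254 (abstract).
-/

/-! ## Scope of (ii): finitely many edges. Finite sums keep a linear Weyl law; a countable direct
sum of the same building blocks (Egger né Endres–Steiner 2011) has the Riemann–von Mangoldt order -/

/-- Finite direct sums stay inside the barrier: a finite sum of counting functions with linear
Weyl laws has a linear Weyl law (so (ii) covers every FINITE graph / finite direct sum, which is
exactly the setting of ES Thm. 15.5: "a finite set of vertices … and a finite set of edges", each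
edge an interval `[a_e, b_e]`, `0 < a_e < b_e < ∞`). [cite: EndresSteiner2010, §6 (definition of a compact graph) and Thm. 15.5] -/
theorem hasLinearWeylLaw_finset_sum {ι : Type*} (s : Finset ι) {N : ι → ℝ → ℝ} {a : ι → ℝ}
    (h : ∀ i ∈ s, HasLinearWeylLaw (N i) (a i)) :
    HasLinearWeylLaw (fun k ↦ ∑ i ∈ s, N i k) (∑ i ∈ s, a i) := by
  have : (fun k ↦ (∑ i ∈ s, N i k) / k) = fun k ↦ ∑ i ∈ s, N i k / k := by
    funext k; rw [Finset.sum_div]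
  unfold HasLinearWeylLaw
  rw [this]
  exact tendsto_finsetSum s h

/-- Layer `n ≥ 1` of the Egger–Steiner infinite quantum graph, rescaled by `1/2π` as in their
Introduction: the wave numbers on the `n`-th edge (Dirichlet interval of length `π/n`, rescaled to
`1/(2n)`) are `2π n m`, `m = 1, 2, …`, so the layer's counting function is `⌊T/(2π n)⌋`
(ES 2011 (8)–(10); equally: the positive eigenvalues `2π n m` of `H_BK` on the loop
`[1, e^{1/n}]` with the cyclic vertex condition). [cite: EggerSteiner2011, §3 (8) and §4 (10)] -/
def esLayerCount (n : ℕ) (T : ℝ) : ℝ := ⌊T / (2 * Real.pi * n)⌋₊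

/-- The divisor summatory function over the reals, `D(x) = Σ_{1 ≤ n ≤ x} ⌊x/n⌋ = #{(n,m) ∈ ℕ²₊ :
n m ≤ x} = Σ_{m ≤ x} d(m)` (Dirichlet). [cite: EggerSteiner2011, §4 (10)–(11)] -/
def divisorSummatory (x : ℝ) : ℝ := ∑ n ∈ Finset.Icc 1 ⌊x⌋₊, (⌊x / n⌋₊ : ℝ)

/-- Wave-number counting function of the whole (rescaled) Egger–Steiner graph = the countable
direct sum of the layers: `N_ES(T) = Σ_{n ≥ 1} ⌊T/(2πn)⌋ = D(T/2π)` (the layers with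
`n > T/2π` contribute `0`, `esLayerCount_eq_zero`). [cite: EggerSteiner2011, §4 (10)] -/
def esGraphCount (T : ℝ) : ℝ := divisorSummatory (T / (2 * Real.pi))

/-- `N_ES(T)` as the sum of its layers `n = 1, …, ⌊T/2π⌋`. [cite: EggerSteiner2011, §4 (10)] -/
theorem esGraphCount_eq_sum (T : ℝ) :
    esGraphCount T = ∑ n ∈ Finset.Icc 1 ⌊T / (2 * Real.pi)⌋₊, esLayerCount n T := by
  unfold esGraphCount divisorSummatory esLayerCount
  refine Finset.sum_congr rfl fun n _ ↦ ?_
  rw [div_div]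

/-- Each layer has a linear Weyl law, `⌊T/(2πn)⌋/T → 1/(2πn)` — so each layer separately, and
every finite collection of layers, is covered by (ii). [cite: EggerSteiner2011, §3 (8)] -/
theorem hasLinearWeylLaw_esLayerCount {n : ℕ} (hn : n ≠ 0) :
    HasLinearWeylLaw (esLayerCount n) (1 / (2 * Real.pi * n)) := by
  have hc : 0 < 2 * Real.pi * n := by positivity
  unfold HasLinearWeylLaw esLayerCount
  -- lower bound `1/c - 1/T`, upper bound `1/c`
  have hlow : Tendsto (fun T : ℝ ↦ 1 / (2 * Real.pi * n) - T⁻¹) atTop (𝓝 (1 / (2 * Real.pi * n))) := by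
    simpa using (tendsto_const_nhds (x := 1 / (2 * Real.pi * n))).sub tendsto_inv_atTop_zero
  refine tendsto_of_tendsto_of_tendsto_of_le_of_le' hlow tendsto_const_nhds ?_ ?_
  · filter_upwards [eventually_gt_atTop 0] with T hT
    have h1 : T / (2 * Real.pi * n) - 1 ≤ ⌊T / (2 * Real.pi * n)⌋₊ := by
      have := Nat.lt_floor_add_one (T / (2 * Real.pi * n))
      linarith
    rw [le_div_iff₀ hT]
    calc (1 / (2 * Real.pi * n) - T⁻¹) * T = T / (2 * Real.pi * n) - 1 := by field_simp
      _ ≤ _ := h1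
  · filter_upwards [eventually_gt_atTop 0] with T hT
    rw [div_le_iff₀ hT]
    calc (⌊T / (2 * Real.pi * n)⌋₊ : ℝ) ≤ T / (2 * Real.pi * n) := Nat.floor_le (by positivity)
      _ = 1 / (2 * Real.pi * n) * T := by field_simp

/-- Layers beyond `⌊T/2π⌋` are empty below `T` (so the finite sum `esGraphCount_eq_sum` is the
whole countable direct sum). [cite: EggerSteiner2011, §4 (10)] -/
theorem esLayerCount_eq_zero {n : ℕ} {T : ℝ} (hn : ⌊T / (2 * Real.pi)⌋₊ < n) :
    esLayerCount n T = 0 := by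
  unfold esLayerCount
  have hn0 : (0 : ℝ) < n := by exact_mod_cast (Nat.zero_le _).trans_lt hn
  have h2π : 0 < 2 * Real.pi := by positivity
  rw [Nat.cast_eq_zero, Nat.floor_eq_zero, div_lt_one (by positivity)]
  have := Nat.lt_of_floor_lt hn
  calc T = T / (2 * Real.pi) * (2 * Real.pi) := by field_simp
    _ < n * (2 * Real.pi) := by gcongr
    _ = 2 * Real.pi * n := by ring

/-- **Dirichlet's bounds, crude form.** `x log x − x ≤ D(x) ≤ x log x + x` for `x ≥ 1`
(from `⌊x/n⌋ ∈ (x/n − 1, x/n]` and `log(⌊x⌋+1) ≤ H_{⌊x⌋} ≤ 1 + log x`). [cite: EggerSteiner2011, §4 (11) (Dirichlet 1849: `D(x) = x log x + (2γ−1)x + O(√x)`)] -/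
theorem divisorSummatory_le {x : ℝ} (hx : 1 ≤ x) :
    divisorSummatory x ≤ x * Real.log x + x := by
  unfold divisorSummatory
  have hx0 : 0 ≤ x := zero_le_one.trans hx
  calc ∑ n ∈ Finset.Icc 1 ⌊x⌋₊, (⌊x / n⌋₊ : ℝ)
      ≤ ∑ n ∈ Finset.Icc 1 ⌊x⌋₊, x * (n : ℝ)⁻¹ := by
        gcongr with n hn
        rw [← div_eq_mul_inv]
        exact Nat.floor_le (by positivity)
    _ = x * harmonic ⌊x⌋₊ := by
        rw [← Finset.mul_sum, harmonic_eq_sum_Icc]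
        push_cast
        rfl
    _ ≤ x * (1 + Real.log x) := by gcongr; exact harmonic_floor_le_one_add_log x hx
    _ = x * Real.log x + x := by ring

/-- Lower half of Dirichlet's crude bounds: `x log x − x ≤ D(x)` for `x ≥ 1`. [cite: EggerSteiner2011, §4 (11)] -/
theorem le_divisorSummatory {x : ℝ} (hx : 1 ≤ x) :
    x * Real.log x - x ≤ divisorSummatory x := by
  unfold divisorSummatory
  have hx0 : 0 ≤ x := zero_le_one.trans hx
  have hM : (⌊x⌋₊ : ℝ) ≤ x := Nat.floor_le hx0
  calc x * Real.log x - x ≤ x * harmonic ⌊x⌋₊ - ⌊x⌋₊ := by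
        gcongr
        exact log_le_harmonic_floor x hx0
    _ = ∑ n ∈ Finset.Icc 1 ⌊x⌋₊, (x * (n : ℝ)⁻¹ - 1) := by
        rw [Finset.sum_sub_distrib, ← Finset.mul_sum, harmonic_eq_sum_Icc]
        push_cast
        simp
    _ ≤ ∑ n ∈ Finset.Icc 1 ⌊x⌋₊, (⌊x / n⌋₊ : ℝ) := by
        gcongr with n hn
        rw [← div_eq_mul_inv, sub_le_iff_le_add]
        exact (Nat.lt_floor_add_one _).le

/-- `D(x)/(x log x) → 1`. [cite: EggerSteiner2011, §4 (11)] -/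
theorem tendsto_divisorSummatory_div :
    Tendsto (fun x ↦ divisorSummatory x / (x * Real.log x)) atTop (𝓝 1) := by
  have hlog : Tendsto (fun x : ℝ ↦ (Real.log x)⁻¹) atTop (𝓝 0) :=
    Real.tendsto_log_atTop.inv_tendsto_atTop
  have hlow : Tendsto (fun x : ℝ ↦ 1 - (Real.log x)⁻¹) atTop (𝓝 1) := by
    simpa using (tendsto_const_nhds (x := (1 : ℝ))).sub hlog
  have hup : Tendsto (fun x : ℝ ↦ 1 + (Real.log x)⁻¹) atTop (𝓝 1) := by
    simpa using (tendsto_const_nhds (x := (1 : ℝ))).add hlog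
  refine tendsto_of_tendsto_of_tendsto_of_le_of_le' hlow hup ?_ ?_
  · filter_upwards [eventually_gt_atTop 1, Real.tendsto_log_atTop.eventually_gt_atTop 0]
      with x hx hlx
    have hpos : 0 < x * Real.log x := by positivity
    rw [le_div_iff₀ hpos]
    calc (1 - (Real.log x)⁻¹) * (x * Real.log x) = x * Real.log x - x := by field_simp
      _ ≤ _ := le_divisorSummatory hx.le
  · filter_upwards [eventually_gt_atTop 1, Real.tendsto_log_atTop.eventually_gt_atTop 0]
      with x hx hlx
    have hpos : 0 < x * Real.log x := by positivity
    rw [div_le_iff₀ hpos]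
    calc divisorSummatory x ≤ x * Real.log x + x := divisorSummatory_le hx.le
      _ = (1 + (Real.log x)⁻¹) * (x * Real.log x) := by field_simp

/-- The Egger–Steiner count is superlinear: `N_ES(T)/T → ∞`; in particular it has no linear
Weyl law, so hypothesis `HasLinearWeylLaw` of (ii) fails for this countable direct sum although it
holds for every layer. [cite: EggerSteiner2011, abstract and §4 (11c)] -/
theorem tendsto_esGraphCount_div_atTop : Tendsto (fun T ↦ esGraphCount T / T) atTop atTop := by
  have h2π : 0 < 2 * Real.pi := by positivity
  have hx : Tendsto (fun T : ℝ ↦ T / (2 * Real.pi)) atTop atTop := tendsto_id.atTop_div_const h2π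
  -- `D(x)/x ≥ log x - 1 → ∞` along `x = T/2π`, and `D(x)/T = (D(x)/x)/(2π)`
  have h1 : Tendsto (fun T : ℝ ↦ (Real.log (T / (2 * Real.pi)) - 1) / (2 * Real.pi)) atTop atTop :=
    (tendsto_atTop_add_const_right _ (-1) (Real.tendsto_log_atTop.comp hx)).atTop_div_const h2π
  refine tendsto_atTop_mono' _ ?_ h1
  filter_upwards [hx.eventually_ge_atTop 1] with T hxT
  have hT : 0 < T := by
    have : (0 : ℝ) < T / (2 * Real.pi) := one_pos.trans_le hxT
    exact (div_pos_iff_of_pos_right h2π).1 this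
  rw [div_le_div_iff₀ h2π hT]
  have := le_divisorSummatory hxT
  unfold esGraphCount
  calc (Real.log (T / (2 * Real.pi)) - 1) * T
      = (T / (2 * Real.pi) * Real.log (T / (2 * Real.pi)) - T / (2 * Real.pi)) * (2 * Real.pi) := by
        field_simp
    _ ≤ divisorSummatory (T / (2 * Real.pi)) * (2 * Real.pi) := by gcongr

/-- … hence `N_ES` has no linear Weyl law: the premise of (ii) is not inherited by countable
direct sums. [cite: EggerSteiner2011, §4 (11c)] -/
theorem not_hasLinearWeylLaw_esGraphCount (a : ℝ) : ¬ HasLinearWeylLaw esGraphCount a := by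
  intro h
  exact not_tendsto_nhds_of_tendsto_atTop tendsto_esGraphCount_div_atTop a h

/-- `N_ES(T) / ((T/2π) log(T/2π)) → 1`: the countable direct sum reproduces the LEADING
Riemann–von Mangoldt term exactly ("whose leading term agrees after an obvious rescaling of the
edge lengths by a factor `1/2π` with the leading term of the counting function for the nontrivial
Riemann zeros"). [cite: EggerSteiner2011, Introduction and §4 (11c)] -/
theorem tendsto_esGraphCount_div_main :
    Tendsto (fun T ↦ esGraphCount T / (T / (2 * Real.pi) * Real.log (T / (2 * Real.pi))))
      atTop (𝓝 1) :=
  tendsto_divisorSummatory_div.comp (tendsto_id.atTop_div_const (by positivity))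

/-- `N_ζ(T) / ((T/2π) log(T/2π)) → 1` from Riemann–von Mangoldt. [cite: Mangoldt1905, Titchmarsh Thm. 9.4] -/
theorem tendsto_zetaZeroCount_div_main (h : Literature.NumberTheory.LFunctions.riemann_von_mangoldt) :
    Tendsto (fun T ↦ (Literature.NumberTheory.LFunctions.zetaZeroCount T : ℝ) /
      (T / (2 * Real.pi) * Real.log (T / (2 * Real.pi)))) atTop (𝓝 1) := by
  have h2π : 0 < 2 * Real.pi := by positivity
  have hx : Tendsto (fun T : ℝ ↦ T / (2 * Real.pi)) atTop atTop := tendsto_id.atTop_div_const h2π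
  have hlog : Tendsto (fun T : ℝ ↦ Real.log (T / (2 * Real.pi))) atTop atTop :=
    Real.tendsto_log_atTop.comp hx
  set main : ℝ → ℝ := fun T ↦ T / (2 * Real.pi) * Real.log (T / (2 * Real.pi)) with hmain
  -- error term / T → 0, and T / main(T) = 2π / log(T/2π) → 0
  have herr : Tendsto (fun T : ℝ ↦ ((Literature.NumberTheory.LFunctions.zetaZeroCount T : ℝ) -
      (T / (2 * Real.pi) * Real.log (T / (2 * Real.pi)) - T / (2 * Real.pi))) / T) atTop (𝓝 0) :=
    (h.trans_isLittleO Real.isLittleO_log_id_atTop).tendsto_div_nhds_zero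
  have hTm : Tendsto (fun T : ℝ ↦ T / main T) atTop (𝓝 0) := by
    have h1 : Tendsto (fun T : ℝ ↦ 2 * Real.pi * (Real.log (T / (2 * Real.pi)))⁻¹) atTop (𝓝 0) := by
      simpa using hlog.inv_tendsto_atTop.const_mul (2 * Real.pi)
    refine h1.congr' ?_
    filter_upwards [eventually_gt_atTop 0] with T hT
    simp only [hmain]
    field_simp
  -- assemble: N/main = (err/T) * (T/main) + 1 - (T/main)/(1) * (1/1) ... write N = err + main - T/2π
  have hkey : ∀ᶠ T in atTop, (Literature.NumberTheory.LFunctions.zetaZeroCount T : ℝ) / main T =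
      ((Literature.NumberTheory.LFunctions.zetaZeroCount T : ℝ) -
        (T / (2 * Real.pi) * Real.log (T / (2 * Real.pi)) - T / (2 * Real.pi))) / T * (T / main T)
        + 1 - (T / main T) / (2 * Real.pi) := by
    filter_upwards [eventually_gt_atTop 0, hlog.eventually_gt_atTop 0] with T hT hlT
    have hm : main T ≠ 0 := by simp only [hmain]; positivity
    simp only [hmain] at hm ⊢
    field_simp
    ring
  have hlim : Tendsto (fun T : ℝ ↦ ((Literature.NumberTheory.LFunctions.zetaZeroCount T : ℝ) -
        (T / (2 * Real.pi) * Real.log (T / (2 * Real.pi)) - T / (2 * Real.pi))) / T * (T / main T)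
        + 1 - (T / main T) / (2 * Real.pi)) atTop (𝓝 (0 * 0 + 1 - 0 / (2 * Real.pi))) :=
    ((herr.mul hTm).add tendsto_const_nhds).sub (hTm.div_const _)
  simp only [zero_mul, zero_add, zero_div, sub_zero] at hlim
  exact (hlim.congr' (hkey.mono fun T hT ↦ hT.symm))

/-- **The evasion, quantified.** Given Riemann–von Mangoldt, `N_ES(T)/N_ζ(T) → 1`: a countable
direct sum of operators each of which is blocked by (ii) has a counting function asymptotic to the
zeta zero count (to leading order; the second-order terms differ, `(2γ−1)T/2π` versus `−T/2π`).
[cite: EggerSteiner2011, Introduction ("suggests that one should consider infinite quantum graphs for this purpose") and §4 (11c)] -/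
theorem tendsto_esGraphCount_div_zetaZeroCount (h : Literature.NumberTheory.LFunctions.riemann_von_mangoldt) :
    Tendsto (fun T ↦ esGraphCount T / (Literature.NumberTheory.LFunctions.zetaZeroCount T : ℝ)) atTop (𝓝 1) := by
  have h2π : 0 < 2 * Real.pi := by positivity
  have hx : Tendsto (fun T : ℝ ↦ T / (2 * Real.pi)) atTop atTop := tendsto_id.atTop_div_const h2π
  have hlog : Tendsto (fun T : ℝ ↦ Real.log (T / (2 * Real.pi))) atTop atTop :=
    Real.tendsto_log_atTop.comp hx
  have hq : Tendsto (fun T ↦ esGraphCount T / (T / (2 * Real.pi) * Real.log (T / (2 * Real.pi))) /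
      ((Literature.NumberTheory.LFunctions.zetaZeroCount T : ℝ) /
        (T / (2 * Real.pi) * Real.log (T / (2 * Real.pi))))) atTop (𝓝 (1 / 1)) :=
    (tendsto_esGraphCount_div_main).div (tendsto_zetaZeroCount_div_main h) one_ne_zero
  rw [div_one] at hq
  refine hq.congr' ?_
  filter_upwards [eventually_gt_atTop 0, hlog.eventually_gt_atTop 0] with T hT hlT
  have hm : T / (2 * Real.pi) * Real.log (T / (2 * Real.pi)) ≠ 0 := by positivity
  rw [div_div_div_cancel_right₀ hm]


/-- **Barrier `BerryKeatingOperatorNarrow`** (audit 2026-08-16 of `BerryKeatingOperator`: the same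
two theorems of Endres–Steiner 2010 with the scope of (ii) made explicit and its boundary exhibited).
Clauses: (1) `BerryKeatingOperator` itself; (2) (ii) is closed under finite sums — a finite sum of
counting functions with linear Weyl laws has one (finite graphs, finite direct sums);
(3) every layer `⌊T/(2πn)⌋` (`n ≥ 1`) of the rescaled Egger né Endres–Steiner infinite graph has a
linear Weyl law, so is blocked separately; (4) their countable direct sum `N_ES = D(T/2π)` has NO
linear Weyl law; (5) `N_ES(T)/N_ζ(T) → 1`. Proved from `riemann_von_mangoldt`
(`BerryKeatingOperatorNarrow_of_riemann_von_mangoldt`); (1)(i) and (2)–(4) outright.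

BARRIER (structured block, D-0021):
- technique_class: Weyl-ordered-xp L2-halfline-point-spectrum finite-compact-quantum-graph H_BK H_BK-squared finite-direct-sum linear-Weyl-law Weyl-law-mismatch
- blocks: (a) a nonzero classical solution of `−i(xψ′ + ψ/2) = kψ`, `k ∈ ℝ`, lying in `L²((0,∞), dx)`; (b) `N_ζ = Literature.NumberTheory.LFunctions.zetaZeroCount` as (eventually equal to, or even eventually `≤`) any counting function with a linear Weyl law `N(k)/k → a` — by ES Thm. 15.4–15.5 the eigenvalue (wave-number) count of every self-adjoint realization of `H_BK` (`H_BK²`) on a FINITE compact graph, finitely many edges `[a_e, b_e] ⊂ (0, ∞)` (ES §6), `a = 𝔏/π` — and, by (2), any finite direct sum of such [cite: EndresSteiner2010, §6, Thm. 15.4–15.6]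
- not_blocked: countably many edges / countable direct sums — clauses (3)–(5): every layer blocked, the sum asymptotic to `N_ζ` [cite: EggerSteiner2011, Introduction and §4 (10)–(11c)]; deformed `xp` on the half-line, `x(p + ℓ_p²/p)` self-adjoint with discrete spectrum and `n(E) ≃ (E/2π)(log(E/ℓ_xℓ_p) − 1) − 1/2`, and `(x + ℓ_x²/x)(p + ℓ_p²/p)` [cite: SierraRodriguezLaguna2011, abstract] [cite: Sierra2019, §5 (h10)] [cite: BerryKeating2011]; the dilation generator on other Hilbert spaces — Connes' cokernel, where its spectrum IS the set of critical zeros [cite: Connes1999, Thm. 1], quotient/Sonine spaces [cite: Burnol2004, §5], finite-dimensional compressions of `H_BK` realising the zeros of Mellin transforms of oscillator eigenfunctions [cite: Srednicki2011, abstract]; non-self-adjoint similarity transforms of `H_BK` with a boundary condition at `0` [cite: BenderBrodyMuller2017, abstract] [cite: Yakaboylu2024, §1]; Bethe-ansatz quantisation [cite: LeClairMussardo2024, abstract]; (audit of the sibling `BerryKeatingOperatorProofs.lean`, same day) the dilation generator `x d/dx` on a NUCLEAR FRÉCHET space of functions on `ℝ*₊`, whose spectrum is exactly the set of ALL nontrivial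 zeros with algebraic multiplicity the zero order of `ξ` (no Hilbert structure at all) [cite: Meyer2004SpectralZeta, §1 p. 3 and §3 p. 8]; and FAMILIES / FINITE WINDOWS on the compact one-loop graph itself — finite-rank perturbations `Θ(λ, k)` of the scaling (Dirac) operator on the circle `ℝ*₊/μ^ℤ` of length `log μ = 2 log λ` reproduce the first 31 zeros as `λ` varies, and the scaling action on `(Σ_μ𝓔(𝒮₀))^⊥ ⊂ L²(ℝ*₊/μ^ℤ)` has spectrum formed by ordinates of critical zeros, every zero `s` occurring for the lengths `log μ ∈ (2π/s)ℕ` (`ζ`-cycles): for fixed `μ` a subset of the lattice `(2π/log μ)ℤ`, hence inside (b), but no statement about ONE fixed operator's FULL spectrum touches a `λ`-family or an initial segment (`exists_hasLinearWeylLaw_eq_zetaZeroCount_of_le` in `BerryKeatingOperatorProofs.lean`: every initial segment of `N_ζ` is realised inside the linear-Weyl class) [cite: ConnesConsani2023, abstract, §1 and Theorem 1.1]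
- because: (a) solutions are `c x^{−1/2+ik}`, `|x^{−1/2+ik}|² = 1/x ∉ L¹` (`halfLine_eigenfunction_eq_zero`); (b) `N(T)/T → a` but `N_ζ(T)/T → ∞` (`eventually_lt_zetaZeroCount_of_hasLinearWeylLaw`); (2) limits commute with finite sums; (3)–(5) `x/n − 1 < ⌊x/n⌋ ≤ x/n` and `log x ≤ H_{⌊x⌋} ≤ 1 + log x` give `x log x − x ≤ D(x) ≤ x log x + x`, so `D(x) ∼ x log x ∼` the Riemann–von Mangoldt main term at `x = T/2π` [cite: EggerSteiner2011, §4 (11)]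
- evasions_known: all published evasions leave the class by (1) infinitely many edges (total log-length `Σ 1/n = ∞`, edge lengths not bounded below), (2) deforming `xp` by non-local terms, (3) changing the Hilbert space (Sobolev-weighted quotients, compressions), or (4) giving up self-adjointness; the only one producing exact zeros as the spectrum of one self-adjoint operator is Connes' cokernel, which sees the critical zeros only [cite: Connes1999, Thm. 1] [cite: Sierra2019, §1]; outside Hilbert space, Meyer's nuclear-space dilation generator produces ALL nontrivial zeros exactly [cite: Meyer2004SpectralZeta, §1 p. 3]; and (5) keeping the compact loop but VARYING it (`μ`-families, finite-rank perturbations, window-by-window matching) is a fifth way out, realised numerically for the first 31 zeros and conceptually by `ζ`-cycles [cite: ConnesConsani2023, §1 and Theorem 1.1]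
- status: established
- scope_caveats: (5) is leading-order only — second terms `(2γ−1)T/2π` (Dirichlet) vs `−T/2π`, and the layer spectrum `{2πnm}` is integrable (nothing is claimed about fluctuations or GUE statistics); the operators (`(H_BK; A, B)`, the infinite Dirichlet graph, the wedge of loops `[1, e^{1/n}]` with cyclic conditions carrying the same count for `H_BK` itself) are not formalised — only their counting functions enter; (a) is the classical-solution form of "purely continuous spectrum"; the general Hilbert–Pólya programme (`Literature/Analysis/UnboundedOperators/HilbertPolya.lean`) is untouched; the EXACT REACH of the density comparison (1)(b) among all counting functions is `N(T)/(T log T) → c ≠ 1/(2π)` — proved unconditionally in `BerryKeatingOperatorProofs.lean` (`tendsto_zetaZeroCount_div_mul_log`: `N_ζ(T)/(T log T) → 1/(2π)`; `eventually_ne_zetaZeroCount_of_tendsto_div_mul_log`; linear laws are `c = 0`, `N_ES` sits exactly at `c = 1/(2π)`, `tendsto_esGraphCount_div_mul_log`), where this block is also discharged (`BerryKeatingOperatorNarrow_holds`); the constant `𝔏/π` printed in ES Thm. 15.5 counts `|k_n| ≤ k` — by Example 16.2 (`k_n = 2π(n + c)/ln(b/a)`, `n ∈ ℤ`) the positive eigenvalues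 alone have slope `𝔏/2π`; immaterial, `HasLinearWeylLaw N a` allows any slope [cite: EndresSteiner2010, Thm. 15.5 and Example 16.2]
[cite: EndresSteiner2010, §6 and Thm. 15.4–15.6] [cite: EggerSteiner2011, abstract, Introduction and §4] -/
def BerryKeatingOperatorNarrow : Prop :=
  BerryKeatingOperator ∧
    (∀ (ι : Type) (s : Finset ι) (N : ι → ℝ → ℝ) (a : ι → ℝ),
        (∀ i ∈ s, HasLinearWeylLaw (N i) (a i)) →
          HasLinearWeylLaw (fun k ↦ ∑ i ∈ s, N i k) (∑ i ∈ s, a i)) ∧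
    (∀ n : ℕ, n ≠ 0 → HasLinearWeylLaw (esLayerCount n) (1 / (2 * Real.pi * n))) ∧
    (∀ a : ℝ, ¬ HasLinearWeylLaw esGraphCount a) ∧
    Tendsto (fun T ↦ esGraphCount T / (Literature.NumberTheory.LFunctions.zetaZeroCount T : ℝ))
      atTop (𝓝 1)

/-- The narrowed barrier from the tree's Riemann–von Mangoldt fact; clauses (1)(i), (2), (3), (4)
are unconditional. [cite: EndresSteiner2010, Thm. 15.6] [cite: EggerSteiner2011, §4 (11c)] -/
theorem BerryKeatingOperatorNarrow_of_riemann_von_mangoldt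
    (h : Literature.NumberTheory.LFunctions.riemann_von_mangoldt) : BerryKeatingOperatorNarrow :=
  ⟨BerryKeatingOperator_of_riemann_von_mangoldt h,
    fun _ι s _N _a hs ↦ hasLinearWeylLaw_finset_sum s hs,
    fun _n hn ↦ hasLinearWeylLaw_esLayerCount hn,
    not_hasLinearWeylLaw_esGraphCount,
    tendsto_esGraphCount_div_zetaZeroCount h⟩

/-- The narrowed block implies the original one (it only adds clauses). [cite: EndresSteiner2010, Thm. 15.6] -/
theorem BerryKeatingOperatorNarrow.toBerryKeatingOperator (h : BerryKeatingOperatorNarrow) :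
    BerryKeatingOperator :=
  h.1

end Literature.Barriers.RiemannHypothesis
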